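import Summits.ResolutionOfSingularities.ResolutionOfSingularities.Theorems.MarkedTransferCampaignW46HostSurfacesSNCAt
import Literature.AlgebraicGeometry.Resolution.CartierDivisorControlledTransform
import Literature.AlgebraicGeometry.Resolution.HypersurfaceRestrictionTransform
import Literature.AlgebraicGeometry.Resolution.OrderSemicontinuity
import Literature.AlgebraicGeometry.Resolution.MonomialPart
import Literature.AlgebraicGeometry.Resolution.BoundarySplitting
import HarnessLib

/-!
# [OURS · L1 W4.6 rung (i), host words] THE IDEAL `J = I · ∏E` ALONG A MARKED BLOW-UP — the transformed boundary multiplies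
# back to the pulled-back boundary, and `I′ · ∏E′` is a controlled transform of `I · ∏E`

Cell res-hironaka, LADDER-RESOLUTION rung L (D-0089), slot W4.6, rung (i) SURFACES in the host item's own words
(`CampaignW46.HypersurfaceOrderReductionDimLE p 2`, res-L1-type-o1's host ladder over MarkedTransfer
`HypersurfaceOrderReductionDimLeThree` stmt-ResolutionOfSingularities-16156); seat res-L1-s46-pv-1 (gen 6). `--kind proof --supports`
stmt-16156 `--as helper`. Everything here is OURS bookkeeping over the tree's blow-up calculus; nothing of H. Hironaka's manuscript
[Hironaka2017] is asserted. AI-written; AI review is weaker than expert review.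

THE DEVICE OF THE SURFACE RUNG. The host rung transforms a marked ideal `(I, E, m)` (BGMW Def. 3.1.3: controlled transform of
`I`, STRICT transforms of the members of `E`, plus the exceptional divisor). The surface loop of res-L1-s46-pv-11's Γ-free rung
(ii-2) runs on ONE effective Cartier ideal and its prime-divisor family. This file shows that the single ideal `J := I · ∏_{D ∈ E} D`
follows the marked transform: along a blow-up `τ` with regular irreducible nowhere-dense centre `C` (generic point `η`),

* `prod_map_strictTransformIdeal` — `𝓘_exc^{s} · ∏_{D ∈ E} σ^{st}(D) = τ^*(∏ E)` with `s = ∑_{D ∈ E} ord_η D` (each member: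
  strict transform = controlled transform with the generic weight, tree `IsBlowup.strictTransformIdeal_eq_controlledTransform`,
  and `τ^*D = 𝓘_exc^{ord_η D} · τᶜ(D, ord_η D)`);
* `controlledTransform_mul_prod_eq` — **`τᶜ(I · ∏E, m + s − 1) = τᶜ(I, m) · ∏ E′`**, `E′ = (strict transforms of E) ++ [exc]`
  (`m ≥ 1`): the ideal `J′ = I′ · ∏E′` of the transformed marked ideal IS a controlled transform of `J`, so pv-11's prime-divisor
  families and measure (`exists_family_measure_lt`, any weight) apply to it verbatim;
* `support_mul_prod_transform_eq` — for the IDENTITY blow-up along an effective Cartier centre `C ⊆ Supp J`: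
  `Supp (I′ · ∏E′) = Supp (I · ∏E)`, hence the same codimension-one points (`divisorialPoints`).

## Sources

* E. Bierstone, D. Grigoriev, P. Milman, J. Włodarczyk, arXiv:1206.3090, Def. 3.1.3 (3)–(5), Lemma 3.7.1. [BierstoneGrigorievMilmanWlodarczyk2011]
* J. Kollár, *Lectures on Resolution of Singularities* (2007), 3.30.2 (birational transform of a divisor). [Kollar2007]
* H. Hironaka, ms. 2017-03-23 — scope only, under adjudication, not cited as fact. [Hironaka2017]
-/

noncomputable section

set_option linter.dupNamespace false -- mandated namespace of this single-conjunct summit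

open CategoryTheory AlgebraicGeometry TopologicalSpace IsLocalRing

namespace Summit.ResolutionOfSingularities.ResolutionOfSingularities.Theorems

namespace CampaignW46

open Literature.AlgebraicGeometry.Resolution
open Scheme.IdealSheafData

universe u

variable {X X' : Scheme.{u}} [IsIntegral X] [IsLocallyNoetherian X] (hX : Scheme.IsRegular X)
  {C : X.IdealSheafData} (hC : Scheme.IsRegular C.subscheme) {η : X} (hη : IsGenericPoint η (C.support : Set X))
  (hint : interior (C.support : Set X) = ∅) {τ : X' ⟶ X} (hτ : IsBlowup τ C)

/-! ## §1 The transformed boundary multiplies back to the pulled-back boundary -/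

include hX hC hη hint hτ in
/-- **`𝓘_exc^{s} · ∏_{D ∈ E} σ^{st}(D) = τ^*(∏_{D ∈ E} D)`**, `s = ∑_{D ∈ E} ord_η D`, for a list `E` of effective Cartier
ideal sheaves `≠ 0` on the regular integral locally Noetherian `X` and a blow-up `τ` along a regular irreducible
nowhere-dense centre with generic point `η` (Kollár 3.30.2 member by member: the strict transform of a divisor is its total
transform minus `ord_η` times the exceptional divisor). [cite: Kollar2007, 3.30.2] -/
theorem prod_map_strictTransformIdeal :
    ∀ E : List X.IdealSheafData, (∀ D ∈ E, IsEffectiveCartier D) → (∀ D ∈ E, D ≠ ⊥) →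
      C.comap τ ^ (E.map fun D => (idealOrder D η).toNat).sum * (E.map (strictTransformIdeal τ C)).prod =
        (E.prod).comap τ
  | [], _, _ => by simp [Scheme.IdealSheafData.comap_top]
  | D :: E, hc, hne => by
    haveI : IsLocallyNoetherian X' := hτ.isLocallyNoetherian
    have hD : idealOrder D η = ((idealOrder D η).toNat : ℕ) := (ENat.coe_toNat (idealOrder_ne_top (hne D (by simp)) η)).symm
    have hst : strictTransformIdeal τ C D = controlledTransform τ C D (idealOrder D η).toNat :=
      hτ.strictTransformIdeal_eq_controlledTransform hX hC hη hint hD (hc D (by simp))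
    have htot : D.comap τ = C.comap τ ^ (idealOrder D η).toNat * controlledTransform τ C D (idealOrder D η).toNat :=
      hτ.comap_eq_pow_mul_controlledTransform_of_le_pow (le_pow_of_idealOrder_genericPoint_eq hX hC hη hD)
    have ih := prod_map_strictTransformIdeal E (fun D' h => hc D' (by simp [h])) (fun D' h => hne D' (by simp [h]))
    rw [List.map_cons, List.sum_cons, List.map_cons, List.prod_cons, List.prod_cons, comap_mul, htot, ← ih, hst, pow_add]
    simp only [mul_assoc, mul_left_comm]

/-! ## §2 `I′ · ∏E′` is a controlled transform of `I · ∏E` -/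

include hX hC hη hint hτ in
/-- **`τᶜ(I · ∏E, m + s − 1) = τᶜ(I, m) · ∏((strict transforms of E) ++ [exc])`**, `s = ∑_{D ∈ E} ord_η D`, `m ≥ 1`,
for `I ⊆ C^m` (so that `τ^*I = 𝓘_exc^m · τᶜ(I, m)`) and `E` a list of effective Cartier ideal sheaves `≠ 0`: the ideal
`J′ = I′ · ∏E′` of the BGMW transform `(I′, E′, m)` of the marked ideal `(I, E, m)` is the controlled transform, with weight
`m + s − 1`, of `J = I · ∏E` (multiplicativity of controlled transforms, BGMW Lemma 3.7.1, and cancellation of the effective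
Cartier exceptional factor). [cite: BierstoneGrigorievMilmanWlodarczyk2011, Lemma 3.7.1] -/
theorem controlledTransform_mul_prod_eq {I : X.IdealSheafData} {m : ℕ} (hm : 1 ≤ m) (hIC : I ≤ C ^ m)
    (E : List X.IdealSheafData) (hc : ∀ D ∈ E, IsEffectiveCartier D) (hne : ∀ D ∈ E, D ≠ ⊥) :
    controlledTransform τ C (I * E.prod) (m + (E.map fun D => (idealOrder D η).toNat).sum - 1) =
      controlledTransform τ C I m * (E.map (strictTransformIdeal τ C) ++ [C.comap τ]).prod := by
  haveI : IsLocallyNoetherian X' := hτ.isLocallyNoetherian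
  set s := (E.map fun D => (idealOrder D η).toNat).sum with hs
  set I' := controlledTransform τ C I m
  set D' := C.comap τ
  have hI : D' ^ m * I' = I.comap τ := hτ.pow_mul_controlledTransform_eq (comap_le_comap_pow_of_le_pow hIC τ)
  have hE := prod_map_strictTransformIdeal hX hC hη hint hτ E hc hne
  -- `τ^*(I ∏E) = D'^{m+s} · I′ · ∏ σ^{st} E = D'^{m+s-1} · (I′ · ∏E′)`
  have hJ : (I * E.prod).comap τ = D' ^ (m + s - 1) * (I' * (E.map (strictTransformIdeal τ C) ++ [D']).prod) := by
    rw [comap_mul, ← hI, ← hE, List.prod_append, List.prod_singleton]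
    obtain ⟨n, hn⟩ : ∃ n, m + s = n + 1 := ⟨m + s - 1, by omega⟩
    rw [show m + s - 1 = n by omega, show D' ^ m * I' * (D' ^ s * (E.map (strictTransformIdeal τ C)).prod) =
      D' ^ (m + s) * (I' * (E.map (strictTransformIdeal τ C)).prod) by rw [pow_add]; simp only [mul_assoc, mul_left_comm], hn,
      pow_succ]
    simp only [mul_assoc, mul_left_comm, mul_comm]
  have hle : (I * E.prod).comap τ ≤ D' ^ (m + s - 1) := by rw [hJ]; exact IdealSheafData.mul_le_right _ _
  have h1 : D' ^ (m + s - 1) * controlledTransform τ C (I * E.prod) (m + s - 1) = (I * E.prod).comap τ :=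
    hτ.pow_mul_controlledTransform_eq hle
  rw [hJ] at h1
  exact (hτ.isEffectiveCartier.pow _).eq_of_mul_eq_mul h1

include hX hC hη hint hτ in
/-- The same identity one exceptional factor up: `𝓘_exc^{m+s} · (I′ · ∏E′) = τ^*(I · ∏E) · 𝓘_exc`. [folklore] -/
theorem pow_mul_mul_prod_transform_eq {I : X.IdealSheafData} {m : ℕ} (hIC : I ≤ C ^ m)
    (E : List X.IdealSheafData) (hc : ∀ D ∈ E, IsEffectiveCartier D) (hne : ∀ D ∈ E, D ≠ ⊥) :
    C.comap τ ^ (m + (E.map fun D => (idealOrder D η).toNat).sum) *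
        (controlledTransform τ C I m * (E.map (strictTransformIdeal τ C) ++ [C.comap τ]).prod) =
      (I * E.prod).comap τ * C.comap τ := by
  haveI : IsLocallyNoetherian X' := hτ.isLocallyNoetherian
  have hI : C.comap τ ^ m * controlledTransform τ C I m = I.comap τ :=
    hτ.pow_mul_controlledTransform_eq (comap_le_comap_pow_of_le_pow hIC τ)
  have hE := prod_map_strictTransformIdeal hX hC hη hint hτ E hc hne
  rw [comap_mul, ← hI, ← hE, List.prod_append, List.prod_singleton, pow_add]
  simp only [mul_assoc, mul_left_comm, mul_comm]

/-! ## §3 Supports along the identity blow-up of a Cartier centre inside `Supp J` -/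

omit [IsIntegral X] [IsLocallyNoetherian X] in
/-- `Supp (K · L) = Supp K ∪ Supp L` and `Supp (K^{n+1}) = Supp K`: the support of a product with a positive power of `P` in
front is `Supp P ∪ Supp (rest)`. [folklore] -/
theorem support_pow_mul_eq {P K : X.IdealSheafData} {n : ℕ} (hn : n ≠ 0) : (P ^ n * K).support = P.support ⊔ K.support := by
  rw [Scheme.IdealSheafData.support_mul, Scheme.IdealSheafData.support_pow _ n hn]

include hX hC hη hint in
/-- **Along the IDENTITY blow-up of an effective Cartier centre `C` contained in `Supp (I · ∏E)`, the ideal `I′ · ∏E′` of the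
transformed marked ideal has the same support as `I · ∏E`** (`C^{m+s} · (I′ ∏E′) = (I ∏E) · C` with `m + s ≥ 1` and
`Supp C ⊆ Supp (I′ ∏E′)`, `C` being the last member of `E′`). In particular the two ideals have the same codimension-one
points. [folklore] -/
theorem support_mul_prod_transform_eq (hCc : IsEffectiveCartier C) {I : X.IdealSheafData} {m : ℕ} (hm : 1 ≤ m)
    (hIC : I ≤ C ^ m) (E : List X.IdealSheafData) (hc : ∀ D ∈ E, IsEffectiveCartier D) (hne : ∀ D ∈ E, D ≠ ⊥)
    (hCJ : C.support ≤ (I * E.prod).support) :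
    (controlledTransform (𝟙 X) C I m * (E.map (strictTransformIdeal (𝟙 X) C) ++ [C.comap (𝟙 X)]).prod).support =
      (I * E.prod).support := by
  have hτ : IsBlowup (𝟙 X) C := IsBlowup.id hCc
  have h := pow_mul_mul_prod_transform_eq hX hC hη hint hτ hIC E hc hne
  simp only [Scheme.IdealSheafData.comap_id] at h ⊢
  set J' := controlledTransform (𝟙 X) C I m * (E.map (strictTransformIdeal (𝟙 X) C) ++ [C]).prod with hJ'
  have hCJ' : C.support ≤ J'.support := by
    have hle : J' ≤ C := by
      rw [hJ']
      exact le_trans (IdealSheafData.mul_le_left _ _) (IdealSheafData.prod_le_of_mem (by simp))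
    exact Scheme.IdealSheafData.support_antitone hle
  have h1 : (C ^ (m + (E.map fun D => (idealOrder D η).toNat).sum) * J').support = C.support ⊔ J'.support :=
    support_pow_mul_eq (by omega)
  rw [h, Scheme.IdealSheafData.support_mul] at h1
  -- `Supp (I∏E) ∪ Supp C = Supp C ∪ Supp J'`
  apply le_antisymm
  · calc J'.support ≤ C.support ⊔ J'.support := le_sup_right
      _ = (I * E.prod).support ⊔ C.support := h1.symm
      _ ≤ (I * E.prod).support := sup_le le_rfl hCJ
  · calc (I * E.prod).support ≤ (I * E.prod).support ⊔ C.support := le_sup_left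
      _ = C.support ⊔ J'.support := h1
      _ ≤ J'.support := sup_le hCJ' le_rfl

omit [IsIntegral X] [IsLocallyNoetherian X] in
/-- Ideal sheaves with the same support have the same codimension-one points. [folklore] -/
theorem divisorialPoints_congr_support {K K' : X.IdealSheafData} (h : K.support = K'.support) :
    divisorialPoints K = divisorialPoints K' := by
  ext ζ
  rw [mem_divisorialPoints_iff, mem_divisorialPoints_iff, h]

end CampaignW46

end Summit.ResolutionOfSingularities.ResolutionOfSingularities.Theorems

end
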